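import Literature.Analysis.OperatorTheory.ResolventEnergyInequality
import Mathlib.Analysis.InnerProductSpace.Calculus
import Mathlib.Analysis.SpecialFunctions.Integrals.Basic
import Mathlib.Analysis.SpecialFunctions.Trigonometric.Deriv
import Mathlib.Analysis.SpecialFunctions.ExpDeriv
import HarnessLib

/-!
# The Gearhart–Prüss theorem for accretive operators with Wei's sharp constant (finite dimension)

**Wei's theorem** (D. Wei, *Diffusion and mixing in fluid flow via the resolvent estimate*, Sci. China
Math. 64 (2021) 507–518, Theorem 1.3): *Let `H` be an m-accretive operator in a Hilbert space `X`. Then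
`‖e^{-tH}‖ ≤ e^{-tΨ(H) + π/2}` for all `t ≥ 0`*, where
`Ψ(H) = inf {‖(H − iλ)f‖ : f ∈ D(H), λ ∈ ℝ, ‖f‖ = 1}` is the pseudospectral abscissa. It turns a
RESOLVENT (pseudospectral) lower bound on the imaginary axis into semigroup decay with NO LOSS IN THE
EXPONENT and the universal prefactor `e^{π/2}` — the tool by which Coti Zelati–Gallay (J. LMS 108 (2023),
Prop. 2.1) convert resolvent estimates for `-ν∂²_y + ikv(y)` into enhanced-dissipation / Taylor-dispersion
decay rates.

This file proves the theorem in FINITE DIMENSION (`E` a finite-dimensional complex inner-product space,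
`H : E →L[ℂ] E` accretive: `Re⟪Hv, v⟫ ≥ 0`), phrased for SOLUTIONS `u` of `u′ = −Hu` on a time interval
in the `HasDerivWithinAt … (Icc a b)` shape used by the Galerkin files of `Literature.Analysis.FluidPDE`
(so that no semigroup theory is needed and the result applies verbatim to Galerkin truncations):

* `antitoneOn_norm_sq_of_accretive`, `norm_le_norm_of_accretive` — accretivity ⇒ `s ↦ ‖u s‖²` is
  non-increasing;
* `norm_le_exp_half_pi_mul_of_resolvent_bound₀` (`a = 0`) / `norm_le_exp_half_pi_mul_of_resolvent_bound`
  — **Wei's bound**: if `Ψ‖v‖ ≤ ‖Hv − iμv‖` for all real `μ` and all `v` (`Ψ > 0`) and `u′ = −Hu` on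
  `[a, b]`, then `‖u t‖ ≤ e^{π/2}·e^{−Ψ(t−a)}‖u a‖` whenever `a ≤ t` and `t + π/(2Ψ) ≤ b`;
* `norm_le_exp_pi_mul_of_resolvent_bound` — the WINDOW form needing the solution only up to time `t`:
  `‖u t‖ ≤ e^{π}·e^{−Ψ(t−a)}‖u a‖` for every `t ∈ [a, b]`.
(Private: the `C¹` gluing lemma, Wei's three-piece weight `exists_weight`, and the four pieces of the
`∫(χ′² − Ψ²χ²)g` bookkeeping.)

PROOF (Wei 2021 §2, followed line by line). WLOG `a = 0`. `g(s) = ‖u s‖²` is non-increasing, so only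
`tΨ > π/2` needs proof. Put `t₁ = π/(4Ψ)`, `t₂ = t − π/(4Ψ)`, `t₃ = t + π/(4Ψ)`, `l = t + π/(2Ψ)` and
take the `C¹` weight `χ = sin(Ψs)` on `[0,t₁]`, `e^{Ψs−π/4}/√2` on `[t₁,t₂]`, `e^{Ψl−π} sin(Ψ(l−s))` on
`[t₂,l]`; `χ(0) = χ(l) = 0`. With `f₁ = χu`, `f₂ = χ′u = f₁′ + Hf₁`, the resolvent energy inequality of
`Literature.Analysis.OperatorTheory.ResolventEnergyInequality` (Wei's Plancherel step, done there with
Fourier series on `[0,l]`) gives `∫₀ˡ χ′²g ≥ Ψ²∫₀ˡ χ²g`, i.e. `∫₀ˡ h g ≥ 0` with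
`h = χ′² − Ψ²χ² = Ψ²cos(2Ψs) | 0 | Ψ²e^{2Ψl−2π}cos(2Ψ(l−s))` on the three pieces. Monotonicity of `g`
and the signs of `h` give `∫₀ˡ hg ≤ (Ψ/2)g(0) − (Ψ/2)e^{2Ψl−2π}g(t)`, whence
`g(t) ≤ e^{2π−2Ψl}g(0) = e^{π−2Ψt}g(0)`.

No definitions, no named facts; everything is proved.
-/

noncomputable section

namespace Literature.Analysis.OperatorTheory

open scoped InnerProductSpace Real
open _root_.Complex MeasureTheory intervalIntegral Set Filter
open _root_.Topology

section Accretive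

variable {E : Type*} [NormedAddCommGroup E] [InnerProductSpace ℂ E]

/-- **Accretivity makes the energy non-increasing**: if `Re⟪Hv, v⟫ ≥ 0` for all `v` and
`u′ = −Hu` on `[a, b]` (derivatives within `[a,b]`), then `s ↦ ‖u s‖²` is antitone on `[a, b]`
(`g′ = −2Re⟪Hu, u⟫ ≤ 0`; Wei: "since `H` is accretive, `g(t)` is decreasing").
[cite: Wei2019, §2, proof of Thm 1.3] -/
theorem antitoneOn_norm_sq_of_accretive (H : E →L[ℂ] E) (hacc : ∀ v, 0 ≤ (⟪H v, v⟫_ℂ).re)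
    {a b : ℝ} {u : ℝ → E} (hu : ∀ s ∈ Icc a b, HasDerivWithinAt u (-(H (u s))) (Icc a b) s) :
    AntitoneOn (fun s => ‖u s‖ ^ 2) (Icc a b) := by
  have hcont : ContinuousOn (fun s => ‖u s‖ ^ 2) (Icc a b) := fun s hs =>
    ((hu s hs).continuousWithinAt.norm).pow 2
  refine antitoneOn_of_hasDerivWithinAt_nonpos (convex_Icc a b) hcont
    (f' := fun s => 2 * (⟪u s, -(H (u s))⟫_ℂ).re) ?_ ?_
  · intro x hx
    rw [interior_Icc] at hx ⊢
    have hux : HasDerivAt u (-(H (u x))) x :=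
      (hu x (Ioo_subset_Icc_self hx)).hasDerivAt (Icc_mem_nhds hx.1 hx.2)
    have h := hux.inner ℂ hux
    have h2 : HasDerivAt (fun t => (⟪u t, u t⟫_ℂ).re)
        ((⟪u x, -(H (u x))⟫_ℂ + ⟪-(H (u x)), u x⟫_ℂ).re) x :=
      (Complex.reCLM.hasFDerivAt.comp_hasDerivAt x h :)
    have h3 : (fun t => ‖u t‖ ^ 2) = fun t => (⟪u t, u t⟫_ℂ).re := by
      funext t; rw [← inner_self_eq_norm_sq (𝕜 := ℂ)]; rfl
    rw [h3]
    refine (h2.congr_deriv ?_).hasDerivWithinAt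
    rw [Complex.add_re, ← inner_conj_symm (u x) (-(H (u x))), Complex.conj_re]
    ring
  · intro x _
    have h := hacc (u x)
    have : (⟪u x, -(H (u x))⟫_ℂ).re = -(⟪H (u x), u x⟫_ℂ).re := by
      rw [inner_neg_right, Complex.neg_re, ← inner_conj_symm, Complex.conj_re]
    rw [this]
    linarith

/-- Consequence: `‖u t‖ ≤ ‖u s‖` for `a ≤ s ≤ t ≤ b`. [cite: Wei2019, §2, proof of Thm 1.3] -/
theorem norm_le_norm_of_accretive (H : E →L[ℂ] E) (hacc : ∀ v, 0 ≤ (⟪H v, v⟫_ℂ).re)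
    {a b : ℝ} {u : ℝ → E} (hu : ∀ s ∈ Icc a b, HasDerivWithinAt u (-(H (u s))) (Icc a b) s)
    {s t : ℝ} (hs : a ≤ s) (hst : s ≤ t) (ht : t ≤ b) : ‖u t‖ ≤ ‖u s‖ := by
  have h := antitoneOn_norm_sq_of_accretive H hacc hu ⟨hs, hst.trans ht⟩ ⟨hs.trans hst, ht⟩ hst
  exact (pow_le_pow_iff_left₀ (norm_nonneg _) (norm_nonneg _) two_ne_zero).mp h

end Accretive

/-! ## The `C¹` weight: gluing and calculus facts -/

section Weight

/-- `C¹` gluing: if `f` and `g` are differentiable everywhere and agree to first order at `p`, then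
`x ↦ if x ≤ p then f x else g x` is differentiable everywhere with the glued derivative. [folklore] -/
private theorem hasDerivAt_ite_le {f g f' g' : ℝ → ℝ} {p : ℝ} (hf : ∀ x, HasDerivAt f (f' x) x)
    (hg : ∀ x, HasDerivAt g (g' x) x) (hfg : f p = g p) (hfg' : f' p = g' p) (x : ℝ) :
    HasDerivAt (fun y => if y ≤ p then f y else g y) (if x ≤ p then f' x else g' x) x := by
  rcases lt_trichotomy x p with hlt | rfl | hgt
  · rw [if_pos hlt.le]
    refine (hf x).congr_of_eventuallyEq ?_
    filter_upwards [Iio_mem_nhds hlt] with y hy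
    rw [if_pos (le_of_lt hy)]
  · rw [if_pos le_rfl]
    have hl : HasDerivWithinAt (fun y => if y ≤ x then f y else g y) (f' x) (Iic x) x :=
      (hf x).hasDerivWithinAt.congr (fun y hy => by rw [if_pos (mem_Iic.mp hy)]) (by rw [if_pos le_rfl])
    have hr : HasDerivWithinAt (fun y => if y ≤ x then f y else g y) (f' x) (Ici x) x := by
      rw [hfg']
      refine (hg x).hasDerivWithinAt.congr (fun y hy => ?_) (by rw [if_pos le_rfl, hfg])
      rcases eq_or_lt_of_le (mem_Ici.mp hy) with h | h
      · rw [← h, if_pos le_rfl, hfg]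
      · rw [if_neg (not_le.mpr h)]
    have h := hl.union hr
    rwa [Iic_union_Ici, hasDerivWithinAt_univ] at h
  · rw [if_neg (not_le.mpr hgt)]
    refine (hg x).congr_of_eventuallyEq ?_
    filter_upwards [Ioi_mem_nhds hgt] with y hy
    rw [if_neg (not_le.mpr hy)]

/-- Continuity of a glued function whose pieces agree at the gluing point. [folklore] -/
private theorem continuous_ite_le {f g : ℝ → ℝ} {p : ℝ} (hf : Continuous f) (hg : Continuous g)
    (hfg : f p = g p) : Continuous fun y => if y ≤ p then f y else g y :=
  Continuous.if_le hf hg continuous_id continuous_const fun x hx => by rw [hx, hfg]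

/-- `d/ds sin(Ψ s) = Ψ cos(Ψ s)`. [folklore] -/
private theorem hasDerivAt_sin_mul (Ψ s : ℝ) :
    HasDerivAt (fun y => Real.sin (Ψ * y)) (Ψ * Real.cos (Ψ * s)) s := by
  have h := ((hasDerivAt_id s).const_mul Ψ).sin
  simp only [id, mul_one] at h
  exact h.congr_deriv (by ring)

/-- `d/ds (A e^{Ψ s − c}) = Ψ A e^{Ψ s − c}`. [folklore] -/
private theorem hasDerivAt_const_mul_exp (A Ψ c s : ℝ) :
    HasDerivAt (fun y => A * Real.exp (Ψ * y - c)) (Ψ * (A * Real.exp (Ψ * s - c))) s := by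
  have h := ((((hasDerivAt_id s).const_mul Ψ).sub_const c).exp).const_mul A
  simp only [id, mul_one] at h
  exact h.congr_deriv (by ring)

/-- `d/ds (A sin(Ψ(l − s))) = −Ψ A cos(Ψ(l − s))`. [folklore] -/
private theorem hasDerivAt_const_mul_sin_sub (A Ψ l s : ℝ) :
    HasDerivAt (fun y => A * Real.sin (Ψ * (l - y))) (-(Ψ * A * Real.cos (Ψ * (l - s)))) s := by
  have h1 : HasDerivAt (fun y => Ψ * (l - y)) (-Ψ) s := by
    have h := ((hasDerivAt_id s).const_sub l).const_mul Ψ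
    simp only [id] at h
    exact h.congr_deriv (by ring)
  have h := (h1.sin).const_mul A
  exact h.congr_deriv (by ring)

end Weight

/-! ## Wei's weight and the four pieces of `∫ (χ′² − Ψ²χ²) g` -/

section WeightPieces

/-- **Wei's `C¹` weight.** For `Ψ > 0` and `Ψt > π/2` there are `χ, χ′ : ℝ → ℝ` with `χ′` the
(continuous) derivative of `χ`, `χ(0) = χ(l) = 0` for `l = t + π/(2Ψ)`, and
`h := χ′² − Ψ²χ²` equal to `Ψ²cos(2Ψx)` on `[0, t₁]`, to `0` on `[t₁, t₂]`, and to
`Ψ²e^{2Ψt−π}cos(2Ψ(l−x))` on `[t₂, ∞)` (`t₁ = π/(4Ψ)`, `t₂ = t − π/(4Ψ)`): Wei's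
`χ = sin(Ψs) | e^{Ψs−π/4}/√2 | e^{Ψl−π}sin(Ψ(l−s))`. [cite: Wei2019, §2, proof of Thm 1.3] -/
private theorem exists_weight {Ψ t : ℝ} (hΨ : 0 < Ψ) (ht : π / 2 < Ψ * t) :
    ∃ χ χ' : ℝ → ℝ, (∀ y, HasDerivAt χ (χ' y) y) ∧ Continuous χ' ∧ χ 0 = 0 ∧
      χ (t + π / (2 * Ψ)) = 0 ∧
      (∀ x ∈ Icc 0 (π / (4 * Ψ)), χ' x ^ 2 - Ψ ^ 2 * χ x ^ 2 = Ψ ^ 2 * Real.cos (2 * Ψ * x)) ∧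
      (∀ x ∈ Icc (π / (4 * Ψ)) (t - π / (4 * Ψ)), χ' x ^ 2 - Ψ ^ 2 * χ x ^ 2 = 0) ∧
      (∀ x, t - π / (4 * Ψ) ≤ x → χ' x ^ 2 - Ψ ^ 2 * χ x ^ 2 =
        Ψ ^ 2 * Real.exp (Ψ * t - π / 2) ^ 2 * Real.cos (2 * Ψ * (t + π / (2 * Ψ) - x))) := by
  set l : ℝ := t + π / (2 * Ψ) with hl
  set t₁ : ℝ := π / (4 * Ψ) with ht₁
  set t₂ : ℝ := t - π / (4 * Ψ) with ht₂
  have hΨne : Ψ ≠ 0 := hΨ.ne'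
  have hΨt₁ : Ψ * t₁ = π / 4 := by rw [ht₁]; field_simp
  have ht₁pos : 0 < t₁ := div_pos Real.pi_pos (by positivity)
  have ht₁t₂ : t₁ < t₂ := by
    rw [ht₁, ht₂]
    have : π / 2 / Ψ < t := by rw [div_lt_iff₀ hΨ]; linarith
    have e : π / 2 / Ψ = π / (4 * Ψ) + π / (4 * Ψ) := by field_simp; ring
    linarith
  have ht₂l : t₂ < l := by
    rw [ht₂, hl]
    have h1 : 0 < π / (4 * Ψ) := ht₁pos
    have h2 : 0 < π / (2 * Ψ) := div_pos Real.pi_pos (by positivity)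
    linarith
  have hexp₂ : Ψ * t₂ - π / 4 = Ψ * t - π / 2 := by rw [ht₂]; field_simp; ring
  have hlt₂ : Ψ * (l - t₂) = 3 * π / 4 := by rw [hl, ht₂]; field_simp; ring
  -- the three pieces and their derivatives
  set A₂ : ℝ := Real.sqrt 2 / 2 with hA₂
  set A₃ : ℝ := Real.exp (Ψ * t - π / 2) with hA₃
  set p1 : ℝ → ℝ := fun y => Real.sin (Ψ * y) with hp1
  set p1' : ℝ → ℝ := fun y => Ψ * Real.cos (Ψ * y) with hp1'
  set p2 : ℝ → ℝ := fun y => A₂ * Real.exp (Ψ * y - π / 4) with hp2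
  set p2' : ℝ → ℝ := fun y => Ψ * (A₂ * Real.exp (Ψ * y - π / 4)) with hp2'
  set p3 : ℝ → ℝ := fun y => A₃ * Real.sin (Ψ * (l - y)) with hp3
  set p3' : ℝ → ℝ := fun y => -(Ψ * A₃ * Real.cos (Ψ * (l - y))) with hp3'
  set q : ℝ → ℝ := fun y => if y ≤ t₂ then p2 y else p3 y with hq
  set q' : ℝ → ℝ := fun y => if y ≤ t₂ then p2' y else p3' y with hq'
  -- special values of sin / cos
  have hsin34 : Real.sin (3 * π / 4) = Real.sqrt 2 / 2 := by
    rw [show 3 * π / 4 = π - π / 4 by ring, Real.sin_pi_sub, Real.sin_pi_div_four]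
  have hcos34 : Real.cos (3 * π / 4) = -(Real.sqrt 2 / 2) := by
    rw [show 3 * π / 4 = π - π / 4 by ring, Real.cos_pi_sub, Real.cos_pi_div_four]
  have hcos32 : Real.cos (3 * π / 2) = 0 := by
    rw [show 3 * π / 2 = π / 2 + π by ring, Real.cos_add_pi, Real.cos_pi_div_two, neg_zero]
  -- first-order matching at the gluing points
  have hm₂ : p2 t₂ = p3 t₂ := by
    simp only [hp2, hp3, hA₂, hA₃]; rw [hexp₂, hlt₂, hsin34]; ring
  have hm₂' : p2' t₂ = p3' t₂ := by
    simp only [hp2', hp3', hA₂, hA₃]; rw [hexp₂, hlt₂, hcos34]; ring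
  have hq₁ : q t₁ = p2 t₁ := by simp only [hq]; rw [if_pos ht₁t₂.le]
  have hq₁' : q' t₁ = p2' t₁ := by simp only [hq']; rw [if_pos ht₁t₂.le]
  have hm₁ : p1 t₁ = q t₁ := by
    rw [hq₁]; simp only [hp1, hp2, hA₂]
    rw [hΨt₁, Real.sin_pi_div_four, sub_self, Real.exp_zero, mul_one]
  have hm₁' : p1' t₁ = q' t₁ := by
    rw [hq₁']; simp only [hp1', hp2', hA₂]
    rw [hΨt₁, Real.cos_pi_div_four, sub_self, Real.exp_zero, mul_one]
  have hqd : ∀ y, HasDerivAt q (q' y) y :=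
    hasDerivAt_ite_le (fun y => hasDerivAt_const_mul_exp A₂ Ψ (π / 4) y)
      (fun y => hasDerivAt_const_mul_sin_sub A₃ Ψ l y) hm₂ hm₂'
  have hq'c : Continuous q' :=
    continuous_ite_le (by simp only [hp2']; fun_prop) (by simp only [hp3']; fun_prop) hm₂'
  refine ⟨fun y => if y ≤ t₁ then p1 y else q y, fun y => if y ≤ t₁ then p1' y else q' y,
    hasDerivAt_ite_le (fun y => hasDerivAt_sin_mul Ψ y) hqd hm₁ hm₁',
    continuous_ite_le (by simp only [hp1']; fun_prop) hq'c hm₁', ?_, ?_, ?_, ?_, ?_⟩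
  · -- `χ 0 = 0`
    simp only [hp1]; rw [if_pos ht₁pos.le, mul_zero, Real.sin_zero]
  · -- `χ l = 0`
    have h1 : ¬ l ≤ t₁ := not_le.mpr (ht₁t₂.trans ht₂l)
    have h2 : ¬ l ≤ t₂ := not_le.mpr ht₂l
    simp only [hq, hp3]; rw [if_neg h1, if_neg h2, sub_self, mul_zero, Real.sin_zero, mul_zero]
  · -- piece 1
    intro x hx
    simp only [hp1, hp1']
    rw [if_pos hx.2, if_pos hx.2, show 2 * Ψ * x = 2 * (Ψ * x) by ring, Real.cos_two_mul,
      Real.sin_sq]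
    ring
  · -- piece 2
    intro x hx
    rcases eq_or_lt_of_le hx.1 with h | h
    · rw [← h]
      simp only [hp1, hp1']
      rw [if_pos le_rfl, if_pos le_rfl, hΨt₁, Real.cos_pi_div_four, Real.sin_pi_div_four]; ring
    · simp only [hq, hq', hp2, hp2']
      rw [if_neg (not_le.mpr h), if_neg (not_le.mpr h), if_pos hx.2, if_pos hx.2]; ring
  · -- piece 3 (from `t₂` on)
    intro x hx
    rcases eq_or_lt_of_le hx with h | h
    · rw [← h]
      simp only [hq, hq', hp2, hp2']
      rw [if_neg (not_le.mpr ht₁t₂), if_neg (not_le.mpr ht₁t₂), if_pos le_rfl, if_pos le_rfl,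
        show 2 * Ψ * (l - t₂) = 2 * (Ψ * (l - t₂)) by ring, hlt₂,
        show 2 * (3 * π / 4) = 3 * π / 2 by ring, hcos32]
      ring
    · simp only [hq, hq', hp3, hp3']
      rw [if_neg (not_le.mpr (ht₁t₂.trans h)), if_neg (not_le.mpr (ht₁t₂.trans h)),
        if_neg (not_le.mpr h), if_neg (not_le.mpr h), show 2 * Ψ * (l - x) = 2 * (Ψ * (l - x)) by ring,
        Real.cos_two_mul]
      linear_combination (-(Ψ ^ 2 * A₃ ^ 2)) * Real.sin_sq (Ψ * (l - x))

/-- Piece `[0, t₁]`: `h = Ψ²cos(2Ψx) ≥ 0` and `g ≤ g(0)` give `∫₀^{t₁} hg ≤ (Ψ/2)g(0)`.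
[cite: Wei2019, §2, proof of Thm 1.3] -/
private theorem weight_piece1_le {Ψ t₁ : ℝ} (hΨ : 0 < Ψ) (hΨt₁ : Ψ * t₁ = π / 4) (ht₁ : 0 < t₁)
    {w g : ℝ → ℝ} (hwg : IntervalIntegrable (fun x => w x * g x) volume 0 t₁)
    (hw : ∀ x ∈ Icc 0 t₁, w x = Ψ ^ 2 * Real.cos (2 * Ψ * x)) (hg : ∀ x ∈ Icc 0 t₁, g x ≤ g 0) :
    ∫ x in (0:ℝ)..t₁, w x * g x ≤ Ψ / 2 * g 0 := by
  have hle : ∫ x in (0:ℝ)..t₁, w x * g x ≤ ∫ x in (0:ℝ)..t₁, (Ψ ^ 2 * g 0) * Real.cos (2 * Ψ * x) := by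
    refine intervalIntegral.integral_mono_on ht₁.le hwg
      (by apply Continuous.intervalIntegrable; fun_prop) fun x hx => ?_
    rw [hw x hx]
    have h2x : 2 * Ψ * x ≤ π / 2 := by nlinarith [hx.2, hΨt₁, hΨ]
    have hcos : 0 ≤ Real.cos (2 * Ψ * x) :=
      Real.cos_nonneg_of_mem_Icc ⟨by nlinarith [hx.1, hΨ, Real.pi_pos], h2x⟩
    have := mul_le_mul_of_nonneg_left (hg x hx) (mul_nonneg (sq_nonneg Ψ) hcos)
    nlinarith [this]
  have hG : ∀ x, HasDerivAt (fun y => Real.sin (2 * Ψ * y) / (2 * Ψ)) (Real.cos (2 * Ψ * x)) x := by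
    intro x
    refine ((hasDerivAt_sin_mul (2 * Ψ) x).div_const (2 * Ψ)).congr_deriv ?_
    field_simp
  have hI : ∫ x in (0:ℝ)..t₁, Real.cos (2 * Ψ * x) = 1 / (2 * Ψ) := by
    rw [intervalIntegral.integral_eq_sub_of_hasDerivAt (fun x _ => hG x)
      (by apply Continuous.intervalIntegrable; fun_prop)]
    rw [show 2 * Ψ * t₁ = 2 * (Ψ * t₁) by ring, hΨt₁, show 2 * (π / 4) = π / 2 by ring,
      Real.sin_pi_div_two, mul_zero, Real.sin_zero, zero_div, sub_zero]
  rw [intervalIntegral.integral_const_mul, hI] at hle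
  calc ∫ x in (0:ℝ)..t₁, w x * g x ≤ Ψ ^ 2 * g 0 * (1 / (2 * Ψ)) := hle
    _ = Ψ / 2 * g 0 := by field_simp

/-- Piece `[t₂, t]`: `h = Ψ²A²cos(2Ψ(l−x)) ≤ 0` and `g ≥ g(t)` give
`∫_{t₂}^{t} hg ≤ −(Ψ/2)A²g(t)`. [cite: Wei2019, §2, proof of Thm 1.3] -/
private theorem weight_piece3_le {Ψ t₂ t l A : ℝ} (hΨ : 0 < Ψ) (h2t : t₂ < t)
    (hlt : Ψ * (l - t) = π / 2) (hlt₂ : Ψ * (l - t₂) = 3 * π / 4) {w g : ℝ → ℝ}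
    (hwg : IntervalIntegrable (fun x => w x * g x) volume t₂ t)
    (hw : ∀ x ∈ Icc t₂ t, w x = Ψ ^ 2 * A ^ 2 * Real.cos (2 * Ψ * (l - x)))
    (hg : ∀ x ∈ Icc t₂ t, g t ≤ g x) :
    ∫ x in t₂..t, w x * g x ≤ -(Ψ / 2 * A ^ 2 * g t) := by
  have hle : ∫ x in t₂..t, w x * g x ≤
      ∫ x in t₂..t, (Ψ ^ 2 * A ^ 2 * g t) * Real.cos (2 * Ψ * (l - x)) := by
    refine intervalIntegral.integral_mono_on h2t.le hwg
      (by apply Continuous.intervalIntegrable; fun_prop) fun x hx => ?_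
    rw [hw x hx]
    have hlo : π / 2 ≤ 2 * Ψ * (l - x) := by nlinarith [hx.2, hlt, hΨ, Real.pi_pos]
    have hhi : 2 * Ψ * (l - x) ≤ π + π / 2 := by nlinarith [hx.1, hlt₂, hΨ, Real.pi_pos]
    have hcos : Real.cos (2 * Ψ * (l - x)) ≤ 0 := Real.cos_nonpos_of_pi_div_two_le_of_le hlo hhi
    have hA : 0 ≤ Ψ ^ 2 * A ^ 2 := by positivity
    have := mul_le_mul_of_nonpos_left (hg x hx) (mul_nonpos_of_nonneg_of_nonpos hA hcos)
    nlinarith [this]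
  have hG : ∀ x, HasDerivAt (fun y => -(1 / (2 * Ψ)) * Real.sin (2 * Ψ * (l - y)))
      (Real.cos (2 * Ψ * (l - x))) x := by
    intro x
    refine (hasDerivAt_const_mul_sin_sub (-(1 / (2 * Ψ))) (2 * Ψ) l x).congr_deriv ?_
    field_simp
  have hsin32 : Real.sin (3 * π / 2) = -1 := by
    rw [show 3 * π / 2 = π / 2 + π by ring, Real.sin_add_pi, Real.sin_pi_div_two]
  have hI : ∫ x in t₂..t, Real.cos (2 * Ψ * (l - x)) = -(1 / (2 * Ψ)) := by
    rw [intervalIntegral.integral_eq_sub_of_hasDerivAt (fun x _ => hG x)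
      (by apply Continuous.intervalIntegrable; fun_prop)]
    rw [show 2 * Ψ * (l - t) = 2 * (Ψ * (l - t)) by ring, hlt,
      show 2 * Ψ * (l - t₂) = 2 * (Ψ * (l - t₂)) by ring, hlt₂, show 2 * (π / 2) = π by ring,
      Real.sin_pi, show 2 * (3 * π / 4) = 3 * π / 2 by ring, hsin32]
    ring
  rw [intervalIntegral.integral_const_mul, hI] at hle
  calc ∫ x in t₂..t, w x * g x ≤ Ψ ^ 2 * A ^ 2 * g t * -(1 / (2 * Ψ)) := hle
    _ = -(Ψ / 2 * A ^ 2 * g t) := by field_simp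

/-- Piece `[t, l]`: `hg ≤ h·g(t₃)` pointwise (sign change of `h` at `t₃`) and `∫ₜˡ h = 0` give
`∫ₜˡ hg ≤ 0`. [cite: Wei2019, §2, proof of Thm 1.3] -/
private theorem weight_piece4_le {Ψ t t₃ l A : ℝ} (hΨ : 0 < Ψ) (ht3 : t ≤ t₃) (h3l : t₃ ≤ l)
    (hlt : Ψ * (l - t) = π / 2) (hlt₃ : Ψ * (l - t₃) = π / 4) {w g : ℝ → ℝ}
    (hwg : IntervalIntegrable (fun x => w x * g x) volume t l)
    (hw : ∀ x ∈ Icc t l, w x = Ψ ^ 2 * A ^ 2 * Real.cos (2 * Ψ * (l - x)))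
    (hg₁ : ∀ x ∈ Icc t t₃, g t₃ ≤ g x) (hg₂ : ∀ x ∈ Icc t₃ l, g x ≤ g t₃) :
    ∫ x in t..l, w x * g x ≤ 0 := by
  have htl : t ≤ l := ht3.trans h3l
  have hle : ∫ x in t..l, w x * g x ≤
      ∫ x in t..l, (Ψ ^ 2 * A ^ 2 * g t₃) * Real.cos (2 * Ψ * (l - x)) := by
    refine intervalIntegral.integral_mono_on htl hwg
      (by apply Continuous.intervalIntegrable; fun_prop) fun x hx => ?_
    rw [hw x hx]
    have hA : 0 ≤ Ψ ^ 2 * A ^ 2 := by positivity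
    rcases le_or_gt x t₃ with h | h
    · have hlo : π / 2 ≤ 2 * Ψ * (l - x) := by nlinarith [h, hlt₃, hΨ, Real.pi_pos]
      have hhi : 2 * Ψ * (l - x) ≤ π + π / 2 := by nlinarith [hx.1, hlt, hΨ, Real.pi_pos]
      have hcos : Real.cos (2 * Ψ * (l - x)) ≤ 0 := Real.cos_nonpos_of_pi_div_two_le_of_le hlo hhi
      have := mul_le_mul_of_nonpos_left (hg₁ x ⟨hx.1, h⟩) (mul_nonpos_of_nonneg_of_nonpos hA hcos)
      nlinarith [this]
    · have hcos : 0 ≤ Real.cos (2 * Ψ * (l - x)) := Real.cos_nonneg_of_mem_Icc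
        ⟨by nlinarith [hx.2, hΨ, Real.pi_pos], by nlinarith [h, hlt₃, hΨ, Real.pi_pos]⟩
      have := mul_le_mul_of_nonneg_left (hg₂ x ⟨h.le, hx.2⟩) (mul_nonneg hA hcos)
      nlinarith [this]
  have hG : ∀ x, HasDerivAt (fun y => -(1 / (2 * Ψ)) * Real.sin (2 * Ψ * (l - y)))
      (Real.cos (2 * Ψ * (l - x))) x := by
    intro x
    refine (hasDerivAt_const_mul_sin_sub (-(1 / (2 * Ψ))) (2 * Ψ) l x).congr_deriv ?_
    field_simp
  have hI : ∫ x in t..l, Real.cos (2 * Ψ * (l - x)) = 0 := by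
    rw [intervalIntegral.integral_eq_sub_of_hasDerivAt (fun x _ => hG x)
      (by apply Continuous.intervalIntegrable; fun_prop)]
    rw [sub_self, mul_zero, Real.sin_zero, mul_zero,
      show 2 * Ψ * (l - t) = 2 * (Ψ * (l - t)) by ring, hlt, show 2 * (π / 2) = π by ring,
      Real.sin_pi, mul_zero, sub_zero]
  rw [intervalIntegral.integral_const_mul, hI, mul_zero] at hle
  exact hle

end WeightPieces

/-! ## Wei's theorem -/

section Main

variable {E : Type*} [NormedAddCommGroup E] [InnerProductSpace ℂ E] [FiniteDimensional ℂ E]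

/-- **Wei's Gearhart–Prüss bound, normalised at `a = 0`.** Let `H` be accretive
(`Re⟪Hv, v⟫ ≥ 0`) with the pseudospectral lower bound `Ψ‖v‖ ≤ ‖Hv − iμv‖` for all real `μ` and
all `v` (`Ψ > 0`), and let `u′ = −Hu` on `[0, T]` (derivatives within `[0, T]`). Then
`‖u t‖ ≤ e^{π/2 − Ψt}‖u 0‖` whenever `0 ≤ t` and `t + π/(2Ψ) ≤ T` — Wei's
`‖e^{−tH}‖ ≤ e^{−tΨ(H) + π/2}` for solutions on a finite window. [cite: Wei2019, Thm 1.3] -/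
theorem norm_le_exp_half_pi_mul_of_resolvent_bound₀ (H : E →L[ℂ] E)
    (hacc : ∀ v, 0 ≤ (⟪H v, v⟫_ℂ).re) {Ψ : ℝ} (hΨ : 0 < Ψ)
    (hres : ∀ (μ : ℝ) (v : E), Ψ * ‖v‖ ≤ ‖H v - ((μ : ℂ) * I) • v‖) {T : ℝ} {u : ℝ → E}
    (hu : ∀ s ∈ Icc 0 T, HasDerivWithinAt u (-(H (u s))) (Icc 0 T) s) {t : ℝ} (ht : 0 ≤ t)
    (htT : t + π / (2 * Ψ) ≤ T) : ‖u t‖ ≤ Real.exp (π / 2 - Ψ * t) * ‖u 0‖ := by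
  have hπΨ : 0 < π / (2 * Ψ) := div_pos Real.pi_pos (by positivity)
  have htT' : t ≤ T := by linarith
  by_cases hcase : Ψ * t ≤ π / 2
  · -- trivial regime: the energy is non-increasing and the prefactor is `≥ 1`
    have h1 : ‖u t‖ ≤ ‖u 0‖ := norm_le_norm_of_accretive H hacc hu le_rfl ht htT'
    have h2 : 1 ≤ Real.exp (π / 2 - Ψ * t) := Real.one_le_exp (by linarith)
    calc ‖u t‖ ≤ ‖u 0‖ := h1
      _ = 1 * ‖u 0‖ := (one_mul _).symm
      _ ≤ Real.exp (π / 2 - Ψ * t) * ‖u 0‖ := mul_le_mul_of_nonneg_right h2 (norm_nonneg _)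
  rw [not_le] at hcase
  -- the times `0 < t₁ < t₂ < t ≤ t₃ ≤ l ≤ T`
  set l : ℝ := t + π / (2 * Ψ) with hl
  set t₁ : ℝ := π / (4 * Ψ) with ht₁
  set t₂ : ℝ := t - π / (4 * Ψ) with ht₂
  set t₃ : ℝ := t + π / (4 * Ψ) with ht₃
  have hΨne : Ψ ≠ 0 := hΨ.ne'
  have hΨt₁ : Ψ * t₁ = π / 4 := by rw [ht₁]; field_simp
  have ht₁pos : 0 < t₁ := div_pos Real.pi_pos (by positivity)
  have ht₁t₂ : t₁ < t₂ := by
    rw [ht₁, ht₂]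
    have : π / 2 / Ψ < t := by rw [div_lt_iff₀ hΨ]; linarith
    have e : π / 2 / Ψ = π / (4 * Ψ) + π / (4 * Ψ) := by field_simp; ring
    linarith
  have ht₂t : t₂ < t := by rw [ht₂]; linarith
  have htt₃ : t ≤ t₃ := by rw [ht₃]; linarith
  have h4 : π / (4 * Ψ) + π / (4 * Ψ) = π / (2 * Ψ) := by field_simp; ring
  have ht₃l : t₃ ≤ l := by rw [ht₃, hl]; linarith
  have hl0 : 0 < l := by linarith
  have hlt₂ : Ψ * (l - t₂) = 3 * π / 4 := by rw [hl, ht₂]; field_simp; ring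
  have hlt : Ψ * (l - t) = π / 2 := by rw [hl]; field_simp; ring
  have hlt₃ : Ψ * (l - t₃) = π / 4 := by rw [hl, ht₃]; field_simp; ring
  -- the solution on `[0, l]`, its energy `g`
  have hul : ∀ s ∈ Icc 0 l, HasDerivWithinAt u (-(H (u s))) (Icc 0 l) s := fun s hs =>
    (hu s ⟨hs.1, hs.2.trans htT⟩).mono (Icc_subset_Icc_right htT)
  have hucont : ContinuousOn u (Icc 0 l) := fun s hs => (hul s hs).continuousWithinAt
  set g : ℝ → ℝ := fun s => ‖u s‖ ^ 2 with hg
  have hganti : AntitoneOn g (Icc 0 l) := antitoneOn_norm_sq_of_accretive H hacc hul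
  have hgcont : ContinuousOn g (Icc 0 l) := (hucont.norm).pow 2
  -- Wei's weight
  obtain ⟨χ, χ', hχd, hχ'c, hχ0, hχl, hw1, hw2, hw3⟩ := exists_weight hΨ hcase
  have hχc : Continuous χ := continuous_iff_continuousAt.2 fun y => (hχd y).continuousAt
  -- Wei's Plancherel step (file `ResolventEnergyInequality`) for `F = χ • u`
  set F : ℝ → E := fun s => χ s • u s with hF
  set F' : ℝ → E := fun s => χ s • (-(H (u s))) + χ' s • u s with hF'
  have hFc : ContinuousOn F (Icc 0 l) := hχc.continuousOn.smul hucont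
  have hF'c : ContinuousOn F' (Icc 0 l) :=
    (hχc.continuousOn.smul (H.continuous.comp_continuousOn hucont).neg).add
      (hχ'c.continuousOn.smul hucont)
  have hFd : ∀ x ∈ Ioo 0 l, HasDerivAt F (F' x) x := fun x hx =>
    (hχd x).smul ((hul x (Ioo_subset_Icc_self hx)).hasDerivAt (Icc_mem_nhds hx.1 hx.2))
  have hF0 : F 0 = 0 := by simp only [hF]; rw [hχ0, zero_smul]
  have hFl : F l = 0 := by simp only [hF]; rw [hχl, zero_smul]
  have hA := sq_mul_integral_norm_sq_le_of_resolvent_bound H hΨ.le hres hl0 hFc hF'c hFd hF0 hFl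
  have hnF : ∀ x, ‖F x‖ ^ 2 = χ x ^ 2 * g x := by
    intro x; simp only [hF, hg]; rw [norm_smul, Real.norm_eq_abs, mul_pow, sq_abs]
  have hnF' : ∀ x, ‖F' x + H (F x)‖ ^ 2 = χ' x ^ 2 * g x := by
    intro x; simp only [hF, hF', hg]
    rw [H.map_smul_of_tower, smul_neg, neg_add_eq_sub, sub_add_cancel, norm_smul, Real.norm_eq_abs,
      mul_pow, sq_abs]
  simp_rw [hnF, hnF'] at hA
  -- `w = χ′² − Ψ²χ²`; `0 ≤ ∫₀ˡ w g`
  set w : ℝ → ℝ := fun x => χ' x ^ 2 - Ψ ^ 2 * χ x ^ 2 with hw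
  have hwc : Continuous w := by simp only [hw]; fun_prop
  have hint : ∀ {a b : ℝ}, 0 ≤ a → a ≤ b → b ≤ l →
      IntervalIntegrable (fun x => w x * g x) volume a b := by
    intro a b ha hab hb
    refine ((hwc.continuousOn.mul hgcont).mono ?_).intervalIntegrable
    rw [uIcc_of_le hab]; exact Icc_subset_Icc ha hb
  have hgi : ∀ (c : ℝ → ℝ), Continuous c → IntervalIntegrable (fun x => c x * g x) volume 0 l := by
    intro c hc
    refine ((hc.continuousOn.mul hgcont).mono ?_).intervalIntegrable
    rw [uIcc_of_le hl0.le]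
  have hK : 0 ≤ ∫ x in (0:ℝ)..l, w x * g x := by
    have e : ∫ x in (0:ℝ)..l, w x * g x =
        (∫ x in (0:ℝ)..l, χ' x ^ 2 * g x) - Ψ ^ 2 * ∫ x in (0:ℝ)..l, χ x ^ 2 * g x := by
      rw [← intervalIntegral.integral_const_mul, ← intervalIntegral.integral_sub
        (hgi _ (by fun_prop)) ((hgi _ (by fun_prop)).const_mul _)]
      refine intervalIntegral.integral_congr fun x _ => ?_
      simp only [hw]; ring
    rw [e]; linarith
  -- the four pieces
  have hK1 : ∫ x in (0:ℝ)..t₁, w x * g x ≤ Ψ / 2 * g 0 :=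
    weight_piece1_le hΨ hΨt₁ ht₁pos (hint le_rfl ht₁pos.le (by linarith)) hw1
      fun x hx => hganti ⟨le_rfl, hl0.le⟩ ⟨hx.1, by linarith [hx.2]⟩ hx.1
  have hK2 : ∫ x in t₁..t₂, w x * g x = 0 := by
    rw [intervalIntegral.integral_congr (g := fun _ => (0:ℝ)) ?_, intervalIntegral.integral_zero]
    intro x hx
    rw [uIcc_of_le ht₁t₂.le] at hx
    change w x * g x = 0
    rw [show w x = 0 from hw2 x hx, zero_mul]
  have hK3 : ∫ x in t₂..t, w x * g x ≤ -(Ψ / 2 * Real.exp (Ψ * t - π / 2) ^ 2 * g t) :=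
    weight_piece3_le hΨ ht₂t hlt hlt₂ (hint (by linarith) ht₂t.le (by linarith))
      (fun x hx => hw3 x hx.1) fun x hx => hganti ⟨by linarith [hx.1], by linarith [hx.2]⟩
        ⟨ht, by linarith⟩ hx.2
  have hK4 : ∫ x in t..l, w x * g x ≤ 0 :=
    weight_piece4_le hΨ htt₃ ht₃l hlt hlt₃ (hint ht (by linarith) le_rfl)
      (fun x hx => hw3 x (by linarith [hx.1]))
      (fun x hx => hganti ⟨by linarith [hx.1], by linarith [hx.2]⟩ ⟨by linarith, ht₃l⟩ hx.2)
      fun x hx => hganti ⟨by linarith, ht₃l⟩ ⟨by linarith [hx.1], hx.2⟩ hx.1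
  have hsplit : ∫ x in (0:ℝ)..l, w x * g x = (∫ x in (0:ℝ)..t₁, w x * g x) +
      (∫ x in t₁..t₂, w x * g x) + (∫ x in t₂..t, w x * g x) + ∫ x in t..l, w x * g x := by
    rw [intervalIntegral.integral_add_adjacent_intervals (hint le_rfl ht₁pos.le (by linarith))
        (hint ht₁pos.le ht₁t₂.le (by linarith)),
      intervalIntegral.integral_add_adjacent_intervals (hint le_rfl (by linarith) (by linarith))
        (hint (by linarith) ht₂t.le (by linarith)),
      intervalIntegral.integral_add_adjacent_intervals (hint le_rfl ht (by linarith))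
        (hint ht (by linarith) le_rfl)]
  -- assemble: `A² g t ≤ g 0` with `A = e^{Ψt − π/2}`
  have hgt : Real.exp (Ψ * t - π / 2) ^ 2 * g t ≤ g 0 := by
    have h := hK
    rw [hsplit, hK2] at h
    nlinarith [hK1, hK3, hK4, hΨ]
  have hsq : ‖u t‖ ^ 2 ≤ (Real.exp (π / 2 - Ψ * t) * ‖u 0‖) ^ 2 := by
    have e : Real.exp (π / 2 - Ψ * t) ^ 2 * Real.exp (Ψ * t - π / 2) ^ 2 = 1 := by
      rw [← mul_pow, ← Real.exp_add, show π / 2 - Ψ * t + (Ψ * t - π / 2) = 0 by ring, Real.exp_zero,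
        one_pow]
    have h0 : 0 ≤ Real.exp (π / 2 - Ψ * t) ^ 2 := by positivity
    calc ‖u t‖ ^ 2 = g t := rfl
      _ = Real.exp (π / 2 - Ψ * t) ^ 2 * (Real.exp (Ψ * t - π / 2) ^ 2 * g t) := by
          rw [← mul_assoc, e, one_mul]
      _ ≤ Real.exp (π / 2 - Ψ * t) ^ 2 * g 0 := mul_le_mul_of_nonneg_left hgt h0
      _ = (Real.exp (π / 2 - Ψ * t) * ‖u 0‖) ^ 2 := by rw [mul_pow]
  exact (pow_le_pow_iff_left₀ (norm_nonneg _) (by positivity) two_ne_zero).mp hsq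

/-- **Wei's Gearhart–Prüss bound on a window `[a, b]`.** Under the hypotheses of
`norm_le_exp_half_pi_mul_of_resolvent_bound₀` with `u′ = −Hu` on `[a, b]`:
`‖u t‖ ≤ e^{π/2}·e^{−Ψ(t−a)}‖u a‖` whenever `a ≤ t` and `t + π/(2Ψ) ≤ b` (the orbit is used up to
time `t + π/(2Ψ)`, as in Wei's proof with `l = t + π/(2Ψ)`). [cite: Wei2019, Thm 1.3] -/
theorem norm_le_exp_half_pi_mul_of_resolvent_bound (H : E →L[ℂ] E)
    (hacc : ∀ v, 0 ≤ (⟪H v, v⟫_ℂ).re) {Ψ : ℝ} (hΨ : 0 < Ψ)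
    (hres : ∀ (μ : ℝ) (v : E), Ψ * ‖v‖ ≤ ‖H v - ((μ : ℂ) * I) • v‖) {a b : ℝ} {u : ℝ → E}
    (hu : ∀ s ∈ Icc a b, HasDerivWithinAt u (-(H (u s))) (Icc a b) s) {t : ℝ} (hat : a ≤ t)
    (htb : t + π / (2 * Ψ) ≤ b) : ‖u t‖ ≤ Real.exp (π / 2 - Ψ * (t - a)) * ‖u a‖ := by
  -- translate to `[0, b - a]`
  set v : ℝ → E := fun s => u (a + s) with hv
  have hvd : ∀ s ∈ Icc 0 (b - a), HasDerivWithinAt v (-(H (v s))) (Icc 0 (b - a)) s := by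
    intro s hs
    have hmem : a + s ∈ Icc a b := ⟨by linarith [hs.1], by linarith [hs.2]⟩
    have hmaps : MapsTo (fun s : ℝ => a + s) (Icc 0 (b - a)) (Icc a b) := fun y hy =>
      ⟨by linarith [hy.1], by linarith [hy.2]⟩
    have h := (hu (a + s) hmem).scomp s ((hasDerivWithinAt_id s (Icc 0 (b - a))).const_add a) hmaps
    simpa [one_smul, Function.comp_def, hv] using h
  have h := norm_le_exp_half_pi_mul_of_resolvent_bound₀ H hacc hΨ hres hvd (t := t - a)
    (sub_nonneg.mpr hat) (by linarith)
  simpa [hv] using h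

/-- **Window form** (no orbit beyond `t` needed): if `u′ = −Hu` on `[a, b]` then for every
`t ∈ [a, b]`, `‖u t‖ ≤ e^{π}·e^{−Ψ(t−a)}‖u a‖` (apply the previous bound at `t − π/(2Ψ)` and use
that the energy is non-increasing on `[t − π/(2Ψ), t]`; for `Ψ(t−a) ≤ π` the claim is weaker than
monotonicity). [cite: Wei2019, Thm 1.3] -/
theorem norm_le_exp_pi_mul_of_resolvent_bound (H : E →L[ℂ] E)
    (hacc : ∀ v, 0 ≤ (⟪H v, v⟫_ℂ).re) {Ψ : ℝ} (hΨ : 0 < Ψ)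
    (hres : ∀ (μ : ℝ) (v : E), Ψ * ‖v‖ ≤ ‖H v - ((μ : ℂ) * I) • v‖) {a b : ℝ} {u : ℝ → E}
    (hu : ∀ s ∈ Icc a b, HasDerivWithinAt u (-(H (u s))) (Icc a b) s) {t : ℝ} (ht : t ∈ Icc a b) :
    ‖u t‖ ≤ Real.exp (π - Ψ * (t - a)) * ‖u a‖ := by
  have hπΨ : 0 < π / (2 * Ψ) := div_pos Real.pi_pos (by positivity)
  by_cases hcase : Ψ * (t - a) ≤ π
  · have h1 : ‖u t‖ ≤ ‖u a‖ := norm_le_norm_of_accretive H hacc hu le_rfl ht.1 ht.2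
    have h2 : 1 ≤ Real.exp (π - Ψ * (t - a)) := Real.one_le_exp (by linarith)
    calc ‖u t‖ ≤ ‖u a‖ := h1
      _ = 1 * ‖u a‖ := (one_mul _).symm
      _ ≤ Real.exp (π - Ψ * (t - a)) * ‖u a‖ := mul_le_mul_of_nonneg_right h2 (norm_nonneg _)
  rw [not_le] at hcase
  set t' : ℝ := t - π / (2 * Ψ) with ht'
  have hΨne : Ψ ≠ 0 := hΨ.ne'
  have hat' : a ≤ t' := by
    rw [ht']
    have : π / Ψ < t - a := by rw [div_lt_iff₀ hΨ]; linarith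
    have e : π / (2 * Ψ) ≤ π / Ψ :=
      div_le_div_of_nonneg_left Real.pi_pos.le hΨ (by linarith)
    linarith
  have h1 := norm_le_exp_half_pi_mul_of_resolvent_bound H hacc hΨ hres hu hat'
    (by rw [ht']; linarith [ht.2])
  have h2 : ‖u t‖ ≤ ‖u t'‖ :=
    norm_le_norm_of_accretive H hacc hu hat' (by rw [ht']; linarith) ht.2
  have e : π / 2 - Ψ * (t' - a) = π - Ψ * (t - a) := by rw [ht']; field_simp; ring
  rw [e] at h1
  exact h2.trans h1

end Main

end Literature.Analysis.OperatorTheory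

end
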